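import Literature.Computability.AlgebraicComplexity.CKSV22FormulaSingularLocusBound
import Literature.Computability.AlgebraicComplexity.FormulaUnfolding
import Literature.Computability.AlgebraicComplexity.PermanentCompleteness
import HarnessLib

/-!
# CKSV 2022, Theorem 3 in the tree's formula-complexity currency (`formulaComplexity`)

P. Chatterjee, M. Kumar, A. She, B. L. Volk, comput. complex. **31** (2022) 8, Theorem 3 ("any
algebraic formula … computing `ESYM(n, 0.1n)` has size at least `Ω(n²)`"). The file
`CKSV22FormulaLowerBound` proves it in the paper's own model (`CKSV2022.Formula`: binary `+`/`×`
trees, size = number of VARIABLE leaves, TeX L800). The tree's standard measure is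
`formulaComplexity f` = least number of gates of a fan-in-two `ArithCircuit` formula computing `f`
(`CircuitDepth.lean`; Bürgisser 2000 §2.1), bridged to weighted binary expressions `WExpr` by
`FormulaUnfolding.lean` (`exists_wexpr_size_le_formulaComplexity`, `WExpr.numVars_le_size_succ`:
a fan-in-two formula with `g` gates has `≤ g + 1` variable leaves).

## What is proved (bridge, assembled in this tree)

* `CKSV2022.exists_formula_of_wexpr` — a weighted expression `e` unfolds to a CKSV formula with the
  same value and `size = e.numVars` (`c₁e₁ + c₂e₂ ↦ (c₁·Φ₁) + (c₂·Φ₂)`, constants are free leaves);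
  hence `CKSV2022.exists_formula_size_le` : some CKSV formula computes `f` with
  `size ≤ formulaComplexity f + 1`.
* `CKSV2022.formulaComplexity_esymm_lower_bound` — **Theorem 3 for `formulaComplexity`**:
  `(n − (d−2))·⌊d/3⌋ ≤ 2·(formulaComplexity e_{n,d} + 1)` (`3 ≤ d ≤ n`, `1, …, n ≠ 0` in `K`).
* `CKSV2022.formulaComplexity_lower_bound_of_isHomogeneous` — the same for any homogeneous `f` of
  degree `d ≥ 3` all of whose primes `⊇ (∂_i f)` have height `≥ c`: `c·⌊d/3⌋ ≤ 2·(E(f) + 1)`.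
* The same two bounds in the currency of BCS arithmetic expressions `ArithExpr` (file
  `PermanentCompleteness.lean`, constructor-identical to `CKSV2022.Formula`, BCS size = number of
  operations = number of leaves − 1): `CKSV2022.exists_formula_of_arithExpr`
  (`Φ.size ≤ φ.size + 1`), `CKSV2022.arithExpr_size_esymm_lower_bound`,
  `CKSV2022.arithExpr_size_lower_bound_of_isHomogeneous`.

D-0026: no named facts, no definitions.

## References
* [ChatterjeeKumarSheVolk2022] — Theorem 3, §5.2 (model).
* [Burgisser2000] P. Bürgisser, *Completeness and Reduction in Algebraic Complexity Theory*, §2.1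
  (expression size; tree: `formulaComplexity`).
-/

noncomputable section

open MvPolynomial Finset

namespace Literature.Computability.AlgebraicComplexity

namespace CKSV2022

open Formula

variable {K : Type*} [Field K] {n : ℕ}

/-- A weighted binary expression unfolds to a CKSV formula with the same value whose number of
variable leaves is `numVars` (the weights become constant leaves, which are free in CKSV's size).
[cite: ChatterjeeKumarSheVolk2022, §5.2 (L800)] -/
theorem exists_formula_of_wexpr (e : WExpr K (Fin n)) :
    ∃ Φ : Formula n K, Φ.eval = e.eval ∧ Φ.size = e.numVars := by
  induction e with
  | var i => exact ⟨Formula.var i, rfl, rfl⟩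
  | const c => exact ⟨Formula.const c, rfl, rfl⟩
  | lin c₁ e₁ c₂ e₂ ih₁ ih₂ =>
    obtain ⟨Φ₁, h₁, s₁⟩ := ih₁
    obtain ⟨Φ₂, h₂, s₂⟩ := ih₂
    refine ⟨Formula.add (Formula.mul (Formula.const c₁) Φ₁) (Formula.mul (Formula.const c₂) Φ₂),
      ?_, ?_⟩
    · simp only [Formula.eval_add, Formula.eval_mul, Formula.eval_const, h₁, h₂, WExpr.eval_lin,
        smul_eq_C_mul]
    · simp [s₁, s₂]
  | mul e₁ e₂ ih₁ ih₂ =>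
    obtain ⟨Φ₁, h₁, s₁⟩ := ih₁
    obtain ⟨Φ₂, h₂, s₂⟩ := ih₂
    exact ⟨Formula.mul Φ₁ Φ₂, by simp [h₁, h₂], by simp [s₁, s₂]⟩

/-- Some CKSV formula computes `f` with at most `formulaComplexity f + 1` variable leaves.
[cite: ChatterjeeKumarSheVolk2022, §5.2 (L800)] -/
theorem exists_formula_size_le (f : MvPolynomial (Fin n) K) :
    ∃ Φ : Formula n K, Φ.eval = f ∧ Φ.size ≤ formulaComplexity f + 1 := by
  obtain ⟨e, he, hs⟩ := exists_wexpr_size_le_formulaComplexity f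
  obtain ⟨Φ, hΦ, hsize⟩ := exists_formula_of_wexpr e
  exact ⟨Φ, hΦ.trans he, by rw [hsize]; exact (WExpr.numVars_le_size_succ e).trans (by omega)⟩

/-- **CKSV 2022, Theorem 3, in the currency `formulaComplexity`** (least number of gates of a
fan-in-two formula): `(n − (d−2))·⌊d/3⌋ ≤ 2·(formulaComplexity e_{n,d} + 1)` for `3 ≤ d ≤ n` and
`1, …, n ≠ 0` in `K` — `Ω(n²)` at `d = 0.1n`. [cite: ChatterjeeKumarSheVolk2022, Theorem 3] -/
theorem formulaComplexity_esymm_lower_bound {d : ℕ} (hd : 3 ≤ d) (hdn : d ≤ n)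
    (hK : ∀ j : ℕ, 1 ≤ j → j ≤ n → (j : K) ≠ 0) :
    (n - (d - 2)) * (d / 3) ≤ 2 * (formulaComplexity (esymm (Fin n) K d) + 1) := by
  obtain ⟨Φ, hΦ, hs⟩ := exists_formula_size_le (esymm (Fin n) K d)
  exact (chatterjeeKumarSheVolk2022_thm_3 hd hdn hK Φ hΦ).trans (Nat.mul_le_mul_left 2 hs)

/-- The same for any homogeneous `f` of degree `d ≥ 3` whose primes `⊇ (∂_i f)` all have height
`≥ c` (CKSV §1.5 closing remark, formula side): `c·⌊d/3⌋ ≤ 2·(formulaComplexity f + 1)`.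
[cite: ChatterjeeKumarSheVolk2022, §1.5 (closing remark), Theorem 3] -/
theorem formulaComplexity_lower_bound_of_isHomogeneous {d c : ℕ} (hd : 3 ≤ d)
    {f : MvPolynomial (Fin n) K} (hf : f.IsHomogeneous d)
    (hc : ∀ P : Ideal (MvPolynomial (Fin n) K), P.IsPrime → (∀ i, pderiv i f ∈ P) →
      (c : ℕ∞) ≤ P.height) :
    c * (d / 3) ≤ 2 * (formulaComplexity f + 1) := by
  obtain ⟨Φ, hΦ, hs⟩ := exists_formula_size_le f
  exact (formula_lower_bound_of_isHomogeneous hd hf hc Φ hΦ).trans (Nat.mul_le_mul_left 2 hs)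

/-! ### The same in the currency of BCS arithmetic expressions (`ArithExpr`) -/

/-- A BCS arithmetic expression (`ArithExpr`, constructor-identical to `CKSV2022.Formula`) is a CKSV
formula with the same value and at most `size + 1` variable leaves (a binary tree with `g`
operations has `g + 1` leaves). [cite: ChatterjeeKumarSheVolk2022, §5.2 (L800)] -/
theorem exists_formula_of_arithExpr (φ : ArithExpr K (Fin n)) :
    ∃ Φ : Formula n K, Φ.eval = φ.eval ∧ Φ.size ≤ φ.size + 1 := by
  induction φ with
  | var i => exact ⟨Formula.var i, rfl, by simp⟩
  | const c => exact ⟨Formula.const c, rfl, by simp⟩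
  | add φ₁ φ₂ ih₁ ih₂ =>
    obtain ⟨Φ₁, h₁, s₁⟩ := ih₁
    obtain ⟨Φ₂, h₂, s₂⟩ := ih₂
    exact ⟨Formula.add Φ₁ Φ₂, by simp [h₁, h₂],
      by simp only [Formula.size_add, ArithExpr.size_add]; omega⟩
  | mul φ₁ φ₂ ih₁ ih₂ =>
    obtain ⟨Φ₁, h₁, s₁⟩ := ih₁
    obtain ⟨Φ₂, h₂, s₂⟩ := ih₂
    exact ⟨Formula.mul Φ₁ Φ₂, by simp [h₁, h₂],
      by simp only [Formula.size_mul, ArithExpr.size_mul]; omega⟩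

/-- **CKSV Theorem 3 for BCS expressions**: an `ArithExpr` computing `e_{n,d}` (`3 ≤ d ≤ n`,
`1, …, n ≠ 0` in `K`) has `(n − (d−2))·⌊d/3⌋ ≤ 2·(size + 1)`.
[cite: ChatterjeeKumarSheVolk2022, Theorem 3] -/
theorem arithExpr_size_esymm_lower_bound {d : ℕ} (hd : 3 ≤ d) (hdn : d ≤ n)
    (hK : ∀ j : ℕ, 1 ≤ j → j ≤ n → (j : K) ≠ 0) (φ : ArithExpr K (Fin n))
    (h : φ.eval = esymm (Fin n) K d) : (n - (d - 2)) * (d / 3) ≤ 2 * (φ.size + 1) := by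
  obtain ⟨Φ, hΦ, hs⟩ := exists_formula_of_arithExpr φ
  exact (chatterjeeKumarSheVolk2022_thm_3 hd hdn hK Φ (hΦ.trans h)).trans (Nat.mul_le_mul_left 2 hs)

/-- The same for any homogeneous `f` of degree `d ≥ 3` whose primes `⊇ (∂_i f)` all have height
`≥ c`: an `ArithExpr` computing `f` has `c·⌊d/3⌋ ≤ 2·(size + 1)`.
[cite: ChatterjeeKumarSheVolk2022, §1.5 (closing remark), Theorem 3] -/
theorem arithExpr_size_lower_bound_of_isHomogeneous {d c : ℕ} (hd : 3 ≤ d)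
    {f : MvPolynomial (Fin n) K} (hf : f.IsHomogeneous d)
    (hc : ∀ P : Ideal (MvPolynomial (Fin n) K), P.IsPrime → (∀ i, pderiv i f ∈ P) →
      (c : ℕ∞) ≤ P.height)
    (φ : ArithExpr K (Fin n)) (h : φ.eval = f) : c * (d / 3) ≤ 2 * (φ.size + 1) := by
  obtain ⟨Φ, hΦ, hs⟩ := exists_formula_of_arithExpr φ
  exact (formula_lower_bound_of_isHomogeneous hd hf hc Φ (hΦ.trans h)).trans
    (Nat.mul_le_mul_left 2 hs)

end CKSV2022

end Literature.Computability.AlgebraicComplexity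

end
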